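import Literature.Geometry.Kaehler.ComplexTorusPolarizationFlatFunctorial
import Literature.Geometry.Kaehler.ComplexTorusPolarizationFlatFourier
import Literature.Geometry.Kaehler.ComplexTorusPhiHFunctorial
import HarnessLib

/-!
# Degrees through the polarisation map: `q! ∫_X c₁(L)^{∧p} ∧ η♭(σ) = (d₁⋯d_g) · p! ∫_σ c₁(L)^{∧q}` for every
# `σ ∈ H_{2q}(X, ℤ)` — Bertrand's `deg_λ(B)/b! = deg_λ(B^⊥)/b'!` on forms, for all cycles and all types — and
# `deg φ_{f^*L} = (deg f)² deg φ_L` (Bertrand 1997 §3 Thm. 3; Lange 2023 Thm. 6.3.5, Props. 1.4.3, 1.4.6, 1.4.7)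

Layer `Literature/Geometry/Kaehler`, namespace `Literature.Geometry.Kaehler.ComplexTorus`; lane `lit-hodgefound`
(Track 2 foundations library), Layer A; sequel of `ComplexTorusPolarizationFlatFunctorial.lean` (§C: the induced
form `σ, τ ↦ ∫_σ η♭(τ)` on `H_k(X, ℤ)` is `(-1)^k`-symmetric) and `ComplexTorusPolarizationFlatFourier.lean`
(Beauville's Thm. 6.3.5 through `η♭`: `η♭(P⁻¹(E^{∧p})) = (-1)^{p+q} (p!/q!) (d₁⋯d_g) E^{∧q}`), prover p09 gen 12, on
the tree's carriers `H_k(X, ℤ) = ⋀^k Λ`, `Hᵏ(X, ℂ) = Alt^k_ℝ(E; ℂ)`, `∫_X = torusIntegral Φ e`, `∫_σ = cycleIntegral`,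
`P = cyclePoincareDualEquiv Φ e`, for a complex torus `X = E/ΦΛ` presented by a symplectic lattice basis of the
polarisation `η` (`IsSymplecticEnum Φ e₀ η d`, type `(d₁, …, d_g)`; `E = ofRealForm η`, `c₁(L) = -E`).

## Sources (verbatim)

* D. Bertrand, *Duality on tori and multiplicative dependence relations* (1997) [cite: Bertrand1997DualityTori],
  §3 (a) Thm. 3, p. 212: "[When `λ` is a principal polarisation, that is, when the kernel `K(λ)` of `φ` is
  trivial, Theorem 3 reduces to the easy equality: `deg_λ(B)/b! = deg_λ(B^⊥)/b'!`. …]"; p. 199: "Over `ℂ`,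
  this boils down to the study of dual subtori in `(ℝ/ℤ)^{2n}`".
* H. Lange, *Abelian Varieties over the Complex Numbers* (2023) [cite: Lange2023AbelianVarietiesComplex], §6.3.2
  Thm. 6.3.5 (Beauville): "`F(L^{·p}/p!) = ((-1)^{g-p}/d) φ_{L*}(L^{·(g-p)}/(g-p)!)`"; §1.4.2 Prop. 1.4.6 (c)
  "`φ̂_L = φ_L`"; §2.5.3 Lemma 2.5.14 (proof): "By definition of Poincaré Duality we have
  `∫_X P(λ_I) ∧ φ = ∫_{λ_I} φ`"; Thm. 2.5.16 (Poincaré's Formula) and Cor. 2.5.17 (d) "`({D}^g) = d₁⋯d_g g! = (L^g)`".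

## What is proved (theorems only; no definition, no named fact)

For every cycle `σ ∈ H_{2q}(X, ℤ)` and `p + q = g` (`e : Fin (2p + 2q) ≃ ι` the enumeration fixing `∫_X` and `P`):

* `torusIntegral_wedgePow_wedge_polFlat_eq_cycleIntegral` — **`∫_X E^{∧p} ∧ η♭(σ) = ∫_σ η♭(P⁻¹(E^{∧p}))`**
  (`∫_X x ∧ φ = ∫_{P⁻¹x} φ` and the symmetry `∫_τ η♭(σ) = ∫_σ η♭(τ)` in even degree);
* **`IsSymplecticEnum.torusIntegral_wedgePow_wedge_polFlat`** —
  **`∫_X E^{∧p} ∧ η♭(σ) = (-1)^{p+q} (p!/q!) (d₁⋯d_g) ∫_σ E^{∧q}`**, and with `c₁(L) = -E`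
  **`IsSymplecticEnum.factorial_mul_torusIntegral_wedgePow_chernClass_wedge_polFlat`** —
  **`q! · ∫_X c₁(L)^{∧p} ∧ η♭(σ) = (d₁⋯d_g) · p! · ∫_σ c₁(L)^{∧q}`**: the `λ`-degree of the polarisation class
  `η♭(σ)` against that of `σ` itself, `∫_X (c₁^p/p!) ∧ η♭(σ) = χ(L) · ∫_σ c₁^q/q!` — for a PRINCIPAL `λ` and
  `σ = [B]` the fundamental class of an abelian subvariety of dimension `b = q` (so `η♭([B]) = cl(B^⊥)`, gen 11's
  duality theorem, `b' = p`) this is exactly Bertrand's "`deg_λ(B)/b! = deg_λ(B^⊥)/b'!`"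
  (`b'! ∫_X θ^{∧b'}… `— tree `IsPrincipalPolarization.degree_div_factorial_eq` for the subvariety case), now for
  EVERY integral cycle `σ`, algebraic or not, and every type;
* `IsSymplecticEnum.factorial_mul_torusIntegral_wedgePow_chernClass_wedge_polFlat_of_principal` — principal case
  `q! ∫_X θ^{∧p} ∧ η♭(σ) = p! ∫_σ θ^{∧q}`.
* §2 **`deg φ_{f^*L} = (deg f)² deg φ_L`** (Prop. 1.4.3 "`deg f̂ = deg f`", Prop. 1.4.6 (d), Prop. 1.4.7): for a
  homomorphism `f = ρ(A) : X₁ → X` of tori of the same dimension, `#K(f^*L) = (deg f)² · #K(L)`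
  (`natCard_kerPhiH_transpose_mul_mul`, Gram matrix `ᵗA G A` of `f^*η`) and
  `[H¹(X₁, ℤ) : (f^*η)♭ H₁(X₁, ℤ)] = (deg f)² · [H¹(X, ℤ) : η♭ H₁(X, ℤ)]` (`relIndex_range_polFlat_pullbackForm_one`).

## References

* [cite: Bertrand1997DualityTori] D. Bertrand, Duality on tori and multiplicative dependence relations,
  J. Austral. Math. Soc. Ser. A 62 (1997), §3 (a) Thm. 3 (p. 212), p. 199.
* [cite: Lange2023AbelianVarietiesComplex] H. Lange, Abelian Varieties over the Complex Numbers (2023), §6.3.2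
  Thm. 6.3.5, §6.2.4 Prop. 6.2.20, §1.4.1 Prop. 1.4.3, §1.4.2 Lemma 1.4.5 / Prop. 1.4.6 (c)(d) / Prop. 1.4.7,
  §2.5.3 Lemma 2.5.14, Thm. 2.5.16, Cor. 2.5.17.
-/

noncomputable section

open scoped Matrix
open Module Function Complex Submodule
open Literature.LinearAlgebra.Alternating

universe uE

namespace Literature.Geometry.Kaehler

namespace ComplexTorus

section Degrees

variable {ι : Type*} [Fintype ι] [LinearOrder ι] {E : Type uE} [NormedAddCommGroup E] [NormedSpace ℂ E]
  (Φ : (ι → ℝ) ≃L[ℝ] E) {g : ℕ} {e₀ : Fin g ⊕ Fin g ≃ ι} {η : E [⋀^Fin 2]→L[ℝ] ℝ} {d : Fin g → ℕ}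
  {G : Matrix ι ι ℤ} {p q : ℕ}

omit [LinearOrder ι] in
/-- **`∫_X E^{∧p} ∧ η♭(σ) = ∫_σ η♭(P⁻¹(E^{∧p}))`** for `σ ∈ H_{2q}(X, ℤ)`: `∫_X x ∧ φ = ∫_{P⁻¹x} φ` (definition of
`P`) and the symmetry `∫_τ η♭(σ) = (-1)^{2q} ∫_σ η♭(τ) = ∫_σ η♭(τ)` of the induced form in even degree.
[cite: Lange2023AbelianVarietiesComplex, §2.5.3 Lemma 2.5.14 (proof: "`∫_X P(λ_I) ∧ φ = ∫_{λ_I} φ`") and §1.4.2 Prop. 1.4.6 (c)] -/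
theorem torusIntegral_wedgePow_wedge_polFlat_eq_cycleIntegral [DecidableEq ι] (hη : IsRiemannForm Φ η)
    (e : Fin (2 * p + 2 * q) ≃ ι) (σ : ⋀[ℤ]^(2 * q) (ι → ℤ)) :
    torusIntegral Φ e ((wedgePow (ofRealForm η) p).wedge (polFlat Φ η (2 * q) σ)) =
      cycleIntegral Φ (2 * q) σ (polFlat Φ η (2 * q) ((cyclePoincareDualEquiv Φ e (k := 2 * q)).symm
        ⟨wedgePow (ofRealForm η) p, hη.wedgePow_ofRealForm_mem_integralForms Φ p⟩)) := by
  rw [← cycleIntegral_cyclePoincareDualEquiv_symm Φ e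
    (⟨wedgePow (ofRealForm η) p, hη.wedgePow_ofRealForm_mem_integralForms Φ p⟩ :
      (integralForms Φ (2 * p)).toIntSubmodule) (polFlat Φ η (2 * q) σ), cycleIntegral_polFlat_comm,
    pow_mul, neg_one_sq, one_pow, one_mul]

/-- **`∫_X E^{∧p} ∧ η♭(σ) = (-1)^{p+q} (p!/q!) (d₁⋯d_g) · ∫_σ E^{∧q}` for every `σ ∈ H_{2q}(X, ℤ)`** (`p + q = g`,
symplectic lattice basis of type `(d₁, …, d_g)`): Beauville's formula through `η♭`
(`η♭(P⁻¹(E^{∧p})) = (-1)^{p+q} (p!/q!) (d₁⋯d_g) E^{∧q}`) integrated over `σ`.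
[cite: Lange2023AbelianVarietiesComplex, §6.3.2 Thm. 6.3.5 with §2.5.3 Lemma 2.5.14 and §1.4.2 Prop. 1.4.6 (c)] [cite: Bertrand1997DualityTori, §3 (a) Thm. 3 (p. 212)] -/
theorem IsSymplecticEnum.torusIntegral_wedgePow_wedge_polFlat (hs : IsSymplecticEnum Φ e₀ η d)
    (hη : IsRiemannForm Φ η) (hG : G.map (Int.cast : ℤ → ℝ) = latticeGram Φ η)
    (hm : q + p = Fintype.card (Fin g)) (e : Fin (2 * p + 2 * q) ≃ ι) (σ : ⋀[ℤ]^(2 * q) (ι → ℤ)) :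
    torusIntegral Φ e ((wedgePow (ofRealForm η) p).wedge (polFlat Φ η (2 * q) σ)) =
      ((-1 : ℂ) ^ (p + q) * p.factorial * (∏ i, (d i : ℂ)) * ((q.factorial : ℂ))⁻¹) *
        cycleIntegral Φ (2 * q) σ (wedgePow (ofRealForm η) q) := by
  rw [torusIntegral_wedgePow_wedge_polFlat_eq_cycleIntegral Φ hη e σ,
    hs.polFlat_cyclePoincareDualEquiv_symm_wedgePow Φ hη hG hm e, map_smul, smul_eq_mul]

/-- **`q! · ∫_X c₁(L)^{∧p} ∧ η♭(σ) = (d₁⋯d_g) · p! · ∫_σ c₁(L)^{∧q}` for every `σ ∈ H_{2q}(X, ℤ)`** (`c₁(L) = -E`,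
`p + q = g`): `∫_X (c₁^p/p!) ∧ η♭(σ) = χ(L) · ∫_σ (c₁^q/q!)`. For a principal `λ = Θ` and `σ = [B]` the
fundamental class of a `q`-dimensional abelian subvariety (`η♭([B]) = cl(B^⊥)`, gen 11's duality theorem) the
left side is `q! deg_λ(B^⊥)` up to the orientation conventions and the right side `p! deg_λ(B)`: Bertrand's
"`deg_λ(B)/b! = deg_λ(B^⊥)/b'!`" — here for every integral cycle and every type.
[cite: Bertrand1997DualityTori, §3 (a) Thm. 3 (p. 212)] [cite: Lange2023AbelianVarietiesComplex, §6.3.2 Thm. 6.3.5, §2.5.3 Thm. 2.5.16 / Cor. 2.5.17] -/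
theorem IsSymplecticEnum.factorial_mul_torusIntegral_wedgePow_chernClass_wedge_polFlat
    (hs : IsSymplecticEnum Φ e₀ η d) (hη : IsRiemannForm Φ η) (hG : G.map (Int.cast : ℤ → ℝ) = latticeGram Φ η)
    (hm : q + p = Fintype.card (Fin g)) (e : Fin (2 * p + 2 * q) ≃ ι) (σ : ⋀[ℤ]^(2 * q) (ι → ℤ)) :
    (q.factorial : ℂ) * torusIntegral Φ e ((wedgePow (-ofRealForm η) p).wedge (polFlat Φ η (2 * q) σ)) =
      (∏ i, (d i : ℂ)) * p.factorial * cycleIntegral Φ (2 * q) σ (wedgePow (-ofRealForm η) q) := by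
  have hq : (q.factorial : ℂ) ≠ 0 := by exact_mod_cast (Nat.factorial_pos _).ne'
  rw [wedgePow_neg, wedgePow_neg, wedge_smul_left_complex, torusIntegral_smul, map_smul, smul_eq_mul,
    hs.torusIntegral_wedgePow_wedge_polFlat Φ hη hG hm e σ, pow_add]
  have h1 : ((-1 : ℂ) ^ p) * (-1) ^ p = 1 := by rw [← mul_pow, neg_mul_neg, one_mul, one_pow]
  have h3 : (q.factorial : ℂ) * ((q.factorial : ℂ))⁻¹ = 1 := mul_inv_cancel₀ hq
  linear_combination ((q.factorial : ℂ) * ((q.factorial : ℂ))⁻¹ * ((-1 : ℂ) ^ q * p.factorial * (∏ i, (d i : ℂ)) *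
      cycleIntegral Φ (2 * q) σ (wedgePow (ofRealForm η) q))) * h1 +
    ((-1 : ℂ) ^ q * p.factorial * (∏ i, (d i : ℂ)) * cycleIntegral Φ (2 * q) σ (wedgePow (ofRealForm η) q)) * h3

/-- **Principal case: `q! · ∫_X θ^{∧p} ∧ η♭(σ) = p! · ∫_σ θ^{∧q}`** for every `σ ∈ H_{2q}(X, ℤ)` (`θ = c₁(Θ) = -E`,
`p + q = g`) — Bertrand's "easy equality `deg_λ(B)/b! = deg_λ(B^⊥)/b'!`" of the principal case, for all cycles.
[cite: Bertrand1997DualityTori, §3 (a) Thm. 3 (p. 212)] [cite: Lange2023AbelianVarietiesComplex, §6.3.2 Thm. 6.3.5 and §2.4.3 (p. 118)] -/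
theorem IsSymplecticEnum.factorial_mul_torusIntegral_wedgePow_chernClass_wedge_polFlat_of_principal
    (hs : IsSymplecticEnum Φ e₀ η d) (hpp : IsPrincipalPolarization Φ η)
    (hG : G.map (Int.cast : ℤ → ℝ) = latticeGram Φ η) (hm : q + p = Fintype.card (Fin g))
    (e : Fin (2 * p + 2 * q) ≃ ι) (σ : ⋀[ℤ]^(2 * q) (ι → ℤ)) :
    (q.factorial : ℂ) * torusIntegral Φ e ((wedgePow (-ofRealForm η) p).wedge (polFlat Φ η (2 * q) σ)) =
      p.factorial * cycleIntegral Φ (2 * q) σ (wedgePow (-ofRealForm η) q) := by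
  rw [hs.factorial_mul_torusIntegral_wedgePow_chernClass_wedge_polFlat Φ hpp.isRiemannForm hG hm e σ,
    Finset.prod_eq_one fun i _ ↦ by rw [hpp.type_eq_one hs.isPolarizationType i, Nat.cast_one], one_mul]

end Degrees

/-! ## §2 `deg φ_{f^*L} = (deg f)² · deg φ_L` (Prop. 1.4.3, 1.4.6 (d), 1.4.7): `#K(f^*L)` and the index of `(f^*η)♭` -/

section PullbackDegree

variable {ι : Type*} [Fintype ι] [DecidableEq ι] {E E₁ : Type*} [NormedAddCommGroup E] [NormedSpace ℂ E]
  [NormedAddCommGroup E₁] [NormedSpace ℂ E₁] (Φ₁ : (ι → ℝ) ≃L[ℝ] E₁) (Φ : (ι → ℝ) ≃L[ℝ] E)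
  {η : E [⋀^Fin 2]→L[ℝ] ℝ} {G A : Matrix ι ι ℤ}

/-- **`#K(f^*L) = (deg f)² · #K(L)`, i.e. `deg φ_{f^*L} = deg f̂ · deg φ_L · deg f`** for a homomorphism
`f = ρ(A) : X₁ → X` of tori of the same dimension (rational representation `A`): the Gram matrix of `f^*η` is
`ᵗA G A` (Prop. 1.4.6 (d), tree `map_transpose_mul_mul_eq_latticeGram_pullbackForm`, `phiH_pullback`), and
`#K = |det|` (Prop. 1.4.7, tree `natCard_kerPhiH`), `deg f̂ = deg f = |det A|` (Prop. 1.4.3, tree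
`natCard_ker_mapMatrixHom`). Both sides vanish when `f` is not an isogeny or `η` is degenerate.
[cite: Lange2023AbelianVarietiesComplex, §1.4.1 Prop. 1.4.3 ("`deg f̂ = deg f`"), §1.4.2 Prop. 1.4.6 (d) and Prop. 1.4.7] -/
theorem natCard_kerPhiH_transpose_mul_mul (G A : Matrix ι ι ℤ) :
    Nat.card (kerPhiH Φ₁ (A.transpose * G * A)) = (Nat.card (mapMatrixHom Φ₁ Φ A).ker) ^ 2 * Nat.card (kerPhiH Φ G) := by
  rw [natCard_kerPhiH, natCard_kerPhiH, natCard_ker_mapMatrixHom, Matrix.det_mul, Matrix.det_mul,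
    Matrix.det_transpose, Int.natAbs_mul, Int.natAbs_mul]
  ring

/-- **`[H¹(X₁, ℤ) : (f^*η)♭(H₁(X₁, ℤ))] = (deg f)² · [H¹(X, ℤ) : η♭(H₁(X, ℤ))]`** — the index of the polarisation map
of the pulled-back polarisation `F^*η` (`F` the `ℂ`-linear analytic representation of the isogeny `f = ρ(A)`,
`Φ ∘ A_ℝ = F ∘ Φ₁`) is `|det(ᵗA G A)| = |det A|² |det G|` (gen 12's `relIndex_range_polFlat_one` for both tori).
[cite: Lange2023AbelianVarietiesComplex, §1.4.1 Prop. 1.4.3, §1.4.2 Prop. 1.4.6 (d) and Prop. 1.4.7] [cite: Bertrand1997DualityTori, §1 (a) (p. 200: "`[M^* : M] = Vol(M)²`")] -/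
theorem relIndex_range_polFlat_pullbackForm_one (hG : G.map (Int.cast : ℤ → ℝ) = latticeGram Φ η)
    (hdet : G.det ≠ 0) {F : E₁ →L[ℂ] E} (hF : ∀ y, Φ ((A.map (Int.cast : ℤ → ℝ)).mulVec y) = F (Φ₁ y))
    (hA : A.det ≠ 0) :
    (LinearMap.range (polFlat Φ₁ (pullbackForm F η) 1)).toAddSubgroup.relIndex (integralForms Φ₁ 1) =
      (Nat.card (mapMatrixHom Φ₁ Φ A).ker) ^ 2 *
        (LinearMap.range (polFlat Φ η 1)).toAddSubgroup.relIndex (integralForms Φ 1) := by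
  have hG₁ := map_transpose_mul_mul_eq_latticeGram_pullbackForm Φ Φ₁ F hF hG
  have hdet₁ : (A.transpose * G * A).det ≠ 0 := by
    rw [Matrix.det_mul, Matrix.det_mul, Matrix.det_transpose]
    exact mul_ne_zero (mul_ne_zero hA hdet) hA
  rw [relIndex_range_polFlat_one Φ₁ hG₁ hdet₁, relIndex_range_polFlat_one Φ hG hdet, natCard_ker_mapMatrixHom,
    Matrix.det_mul, Matrix.det_mul, Matrix.det_transpose, Int.natAbs_mul, Int.natAbs_mul]
  ring

end PullbackDegree

end ComplexTorus

end Literature.Geometry.Kaehler
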